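import Summits.BirchSwinnertonDyer.BirchSwinnertonDyer.Theorems.PrintX6EisensteinHalfFiveLeGlue
import Summits.BirchSwinnertonDyer.BirchSwinnertonDyer.Theorems.PrintX6EisensteinHalfFiveLeErr
import Summits.BirchSwinnertonDyer.Rank1Residual.Supersingular.X6RankZeroLeafTarget
import Literature.NumberTheory.EllipticCurves.ComplexMultiplicationNotSemistable
import HarnessLib

/-!
# Route `PrintX6` after the Err child closed: the leaf's deficit is EXACTLY the declared residual
# `EisensteinHalfFiveLeRest ∧ EisensteinHalfAtThree` (route currency and leaf currency)

HONEST FRAMING (cell `bsd-print-x6`, run/shared/lean/pub/bsd-print-x6/; PRINT tier D-0131 (2);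
prover p2, PLAN.md v4.2 § p2 lane). THEOREMS ONLY; bookkeeping over landed theorems; nothing about any
particular curve is asserted; BSD is not proved by any of this; no cell of the partition moves. Every
statement is CONDITIONAL on the route's two input conjunctions, taken as hypotheses BY NAME:
`PublishedInputsX6` (nine refereed facts: Kobayashi 2003 Thm 1.2 / Thm 4.1, B. D. Kim 2013 Cor 3.15,
the period units at `p ≥ 5` and at `3`, Wuthrich 2014 Lemma 20, modularity ×2, GZK) and the
anticyclotomic pack `PublishedAcInputsX6Err` (ten facts; tier HELD on its conjunct (10), the referee
rules).

STATE OF THE ROUTE (rev 9). EDIT #4 split the crux `EisensteinHalfFiveLe` (E₅) along ty2's decidable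
predicate `Supersingular.HasErratumPrime W p` into `EisensteinHalfFiveLeErr` (pack → E₅ on the erratum
sub-locus) and `EisensteinHalfFiveLeRest` (E₅ off it), with glue `EisensteinHalfFiveLeOfParts`
(p551953, this seat). The Err child is now CLOSED by prover p3's
`AnticyclotomicRankZero.eisensteinHalfFiveLeErr_holds` (p553619). This file discharges the `hErr`
binder of the glue file's §F with that theorem:

* §1 (route currency) `PublishedAcInputsX6Err → (EisensteinHalfFiveLe ↔ EisensteinHalfFiveLeRest)` —
  the parent crux is now equivalent to its residual child; and
  `PublishedInputsX6 → PublishedAcInputsX6Err → (WAllCornerX6r0 ↔ EisensteinHalfFiveLeRest ∧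
  EisensteinHalfAtThree)` — the rung W-ALL/6 (leaf `ClassX6 ∧ r_an = 0`) holds IFF the two cruxes the
  route declares RESIDUAL hold (tribunal_fit.residual = [EisensteinHalfAtThree, EisensteinHalfFiveLeRest]);
  plus the closing shape `… → EisensteinHalfFiveLeRest → EisensteinHalfAtThree → WAllCornerX6r0`.
* §2 (leaf currency, Miller's `BSDp`) pair level: on the erratum sub-locus at `p ≥ 5` every pair of the
  leaf is `BSD(E,p)` over the two input conjunctions (upper half = the route's PROVED `UpperHalfX6`,
  lower half = the closed Err child, value-cell split `missingPPartAt_of_upper_of_nonUnit`); off it, the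
  same from the Rest child. Class level: over the inputs the rung is equivalent to «`BSD(E,p)` at every
  leaf pair with `p ≥ 5` and `¬ HasErratumPrime W p`» ∧ «`BSD(E,p)` at every leaf pair with `p = 3`» —
  the residual as a set of (E, p) pairs. On the census of record (ty3 p551397/p553688) the first set
  meets 6 of the 113 non-unit cells at `p ≥ 5` (all bad primes split multiplicative), the second all
  621 cells at `p = 3`; class-wide both are infinite families.

beyond-print theorem: NO (bookkeeping). PARTITION: 0 cells.
[cite: Kobayashi2003, Thm. 1.2 (p. 2) and Thm. 4.1 (p. 8)] [cite: BDKim2013, Cor. 3.15 (p. 199)]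
[cite: Miller2011LMS, §1 and Def. 1.1]
-/

set_option autoImplicit false
-- the landed namespace `Summit.BirchSwinnertonDyer.BirchSwinnertonDyer.Theorems` (summit = problem) trips the linter
set_option linter.dupNamespace false

open WeierstrassCurve Literature.NumberTheory.EllipticCurves
  Literature.NumberTheory.EllipticCurves.Rank1Residual
  Literature.NumberTheory.EllipticCurves.Rank1Residual.Typed
  Summit.BirchSwinnertonDyer.BirchSwinnertonDyer.Theses.PrintX6
-- only these two names from ty2's namespace (its `PublishedAcInputsX6Err` would clash with the route's)
open Summit.BirchSwinnertonDyer.Rank1Residual.Supersingular (HasErratumPrime missingPPartAt_of_upper_of_nonUnit)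

namespace Summit.BirchSwinnertonDyer.BirchSwinnertonDyer.Theorems

/-! ## §1 Route currency, Err discharged by `AnticyclotomicRankZero.eisensteinHalfFiveLeErr_holds` -/

/-- **Given the pack, the parent crux E₅ IS its residual child**:
`PublishedAcInputsX6Err → (EisensteinHalfFiveLe ↔ EisensteinHalfFiveLeRest)` — the glue file's
`eisensteinHalfFiveLe_iff_children_of_publishedAcInputsX6Err` with the Err child supplied by p3's closer.
CONDITIONAL on the pack (tier HELD). [cite: Miller2011LMS, Def. 1.1] -/
theorem eisensteinHalfFiveLe_iff_rest_of_publishedAcInputsX6Err (hAc : PublishedAcInputsX6Err) :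
    EisensteinHalfFiveLe ↔ EisensteinHalfFiveLeRest := by
  rw [eisensteinHalfFiveLe_iff_children_of_publishedAcInputsX6Err hAc]
  exact ⟨fun h => h.2, fun h => ⟨AnticyclotomicRankZero.eisensteinHalfFiveLeErr_holds, h⟩⟩

/-- **Closing shape of the parent crux**: the pack and the residual child give back E₅ (the glue with
its Err binder discharged). CONDITIONAL on the pack. [cite: Miller2011LMS, Def. 1.1] -/
theorem eisensteinHalfFiveLe_of_publishedAcInputsX6Err_of_rest (hAc : PublishedAcInputsX6Err)
    (hRest : EisensteinHalfFiveLeRest) : EisensteinHalfFiveLe :=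
  eisensteinHalfFiveLe_of_publishedAcInputsX6Err_of_err_of_rest hAc
    AnticyclotomicRankZero.eisensteinHalfFiveLeErr_holds hRest

/-- **The declared residual IS the deficit (route currency, Err discharged)**: granted the nine
refereed inputs `PublishedInputsX6` and the anticyclotomic pack `PublishedAcInputsX6Err`, the rung
`WAllCornerX6r0` (leaf `ClassX6 ∧ r_an = 0`) holds IFF `EisensteinHalfFiveLeRest ∧ EisensteinHalfAtThree`
— exactly the route's `tribunal_fit.residual`. Nothing else of the leaf is missing over these inputs,
and nothing less suffices. (`wallCornerX6r0_iff_rest_and_atThree_of_publishedInputsX6_of_err` with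
`hErr := AnticyclotomicRankZero.eisensteinHalfFiveLeErr_holds`.)
[cite: Kobayashi2003, Thm. 1.2 (p. 2) and Thm. 4.1 (p. 8)] [cite: BDKim2013, Cor. 3.15 (p. 199)]
[cite: Miller2011LMS, §1 and Def. 1.1] -/
theorem wallCornerX6r0_iff_rest_and_atThree_of_publishedInputsX6_of_publishedAcInputsX6Err
    (hPub : PublishedInputsX6) (hAc : PublishedAcInputsX6Err) :
    Summit.BirchSwinnertonDyer.WAllCornerX6r0 ↔ (EisensteinHalfFiveLeRest ∧ EisensteinHalfAtThree) :=
  wallCornerX6r0_iff_rest_and_atThree_of_publishedInputsX6_of_err hPub hAc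
    AnticyclotomicRankZero.eisensteinHalfFiveLeErr_holds

/-- **Closing shape of the rung**: `PublishedInputsX6 → PublishedAcInputsX6Err →
EisensteinHalfFiveLeRest → EisensteinHalfAtThree → WAllCornerX6r0` — what a closer of the two residual
cruxes composes into (the route's `closes` ∘ glue, Err discharged). CONDITIONAL on both input
conjunctions. [cite: Miller2011LMS, §1 and Def. 1.1] -/
theorem wallCornerX6r0_of_publishedInputsX6_of_publishedAcInputsX6Err_of_rest_of_atThree
    (hPub : PublishedInputsX6) (hAc : PublishedAcInputsX6Err) (hRest : EisensteinHalfFiveLeRest)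
    (h3 : EisensteinHalfAtThree) : Summit.BirchSwinnertonDyer.WAllCornerX6r0 :=
  (wallCornerX6r0_iff_rest_and_atThree_of_publishedInputsX6_of_publishedAcInputsX6Err hPub hAc).2
    ⟨hRest, h3⟩

/-! ## §2 Leaf currency (`BSDp`): the erratum sub-leaf pair by pair; the residual as a set of pairs -/

section PairLevel

variable (W : WeierstrassCurve ℚ) [W.IsElliptic] [W.IsGloballyMinimal] (p : ℕ) [Fact p.Prime]

/-- **Pair level, erratum sub-locus: `BSD(E,p)` over the two input conjunctions.** For a pair of the
leaf (`ClassX6 W p`, `r_an = 0`) with `p ≥ 5` and an erratum prime (`HasErratumPrime W p`): upper half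
by the route's PROVED `UpperHalfX6` (`upperHalfX6_proof`: Kobayashi Thm 4.1 integral clause + Thm 1.2 +
Kim Cor 3.15 + period unit + modularity, from `PublishedInputsX6`), lower half on the non-unit value by
the CLOSED Err child (`eisensteinHalfFiveLeErr_holds`, from the pack; `¬ CM` by `ClassX6.not_hasCM`),
value-cell split `missingPPartAt_of_upper_of_nonUnit`, then `bsdp_of_missingPPartAt` with GZK (ninth
input). CONDITIONAL on both conjunctions (pack tier HELD); per pair it is what the 107 Err census cells
at `p ≥ 5` inherit. [cite: Kobayashi2003, Thm. 1.2 (p. 2) and Thm. 4.1 (p. 8)]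
[cite: BDKim2013, Cor. 3.15 (p. 199)] [cite: Miller2011LMS, §1 and Def. 1.1] -/
theorem X6.bsdp_of_publishedInputsX6_of_publishedAcInputsX6Err_of_hasErratumPrime
    (hPub : PublishedInputsX6) (hAc : PublishedAcInputsX6Err) (h5 : 5 ≤ p) (hX : ClassX6 W p)
    (h0 : W.analyticRank = 0) (hE : HasErratumPrime W p) : BSDp W p :=
  bsdp_of_missingPPartAt W p hPub.2.2.2.2.2.2.2.2 (by omega)
    (missingPPartAt_of_upper_of_nonUnit W p (upperHalfX6_proof hPub W p (by omega) hX h0)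
      (AnticyclotomicRankZero.eisensteinHalfFiveLeErr_holds hAc W p (ClassX6.not_hasCM W hX) h5 hX h0
        hE))

/-- **Pair level, off the erratum sub-locus: `BSD(E,p)` from the residual crux.** Same composition with
the Rest child `EisensteinHalfFiveLeRest` as the lower half (no pack needed). CONDITIONAL on
`PublishedInputsX6` and on the OPEN residual crux. [cite: Kobayashi2003, Thm. 1.2 (p. 2) and Thm. 4.1 (p. 8)]
[cite: BDKim2013, Cor. 3.15 (p. 199)] [cite: Miller2011LMS, §1 and Def. 1.1] -/
theorem X6.bsdp_of_publishedInputsX6_of_rest_of_not_hasErratumPrime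
    (hPub : PublishedInputsX6) (hRest : EisensteinHalfFiveLeRest) (h5 : 5 ≤ p) (hX : ClassX6 W p)
    (h0 : W.analyticRank = 0) (hE : ¬ HasErratumPrime W p) : BSDp W p :=
  bsdp_of_missingPPartAt W p hPub.2.2.2.2.2.2.2.2 (by omega)
    (missingPPartAt_of_upper_of_nonUnit W p (upperHalfX6_proof hPub W p (by omega) hX h0)
      (hRest W p (ClassX6.not_hasCM W hX) h5 hX h0 hE))

/-- **Pair level, `p = 3`: `BSD(E,3)` from the `p = 3` residual crux.** CONDITIONAL on
`PublishedInputsX6` and on the OPEN crux `EisensteinHalfAtThree`.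
[cite: Kobayashi2003, Thm. 1.2 (p. 2) and Thm. 4.1 (p. 8)] [cite: BDKim2013, Cor. 3.15 (p. 199)]
[cite: Miller2011LMS, §1 and Def. 1.1] -/
theorem X6.bsdp_of_publishedInputsX6_of_atThree (hPub : PublishedInputsX6) (hT : EisensteinHalfAtThree)
    (h3 : p = 3) (hX : ClassX6 W p) (h0 : W.analyticRank = 0) : BSDp W p :=
  bsdp_of_missingPPartAt W p hPub.2.2.2.2.2.2.2.2 (by omega)
    (missingPPartAt_of_upper_of_nonUnit W p (upperHalfX6_proof hPub W p (by omega) hX h0)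
      (hT W p (ClassX6.not_hasCM W hX) h3 hX h0))

end PairLevel

/-- An odd prime other than `3` is at least `5`. -/
private theorem five_le_of_odd_prime_ne_three {p : ℕ} (hp : p.Prime) (h2 : p ≠ 2)
    (h3 : p ≠ 3) : 5 ≤ p := by
  by_contra hlt
  have h2le := hp.two_le
  interval_cases p
  · exact absurd rfl h2
  · exact absurd rfl h3
  · exact absurd hp (by decide)

/-- **The residual as a set of (E, p) pairs (leaf currency).** Over `PublishedInputsX6` and the pack
`PublishedAcInputsX6Err`, the rung `WAllCornerX6r0` holds IFF `BSD(E,p)` holds (i) at every pair of the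
leaf with `p ≥ 5` and NO erratum prime (`¬ HasErratumPrime W p`: every multiplicative prime `q` of `E`
is split or has `p ∣ ord_q Δ`) and (ii) at every pair of the leaf with `p = 3`. `→`: specialisation
(`¬ CM` is automatic on X6, `ClassX6.not_hasCM`); `←`: an odd prime is `3` or `≥ 5`, and at `p ≥ 5` the
erratum sub-locus is `BSD(E,p)` by `X6.bsdp_of_publishedInputsX6_of_publishedAcInputsX6Err_of_hasErratumPrime`
(classical case split on `HasErratumPrime W p`). On the census of record (i) meets 6 of 113 non-unit
cells at `p ≥ 5`, (ii) all 621 at `p = 3` (ty3 p551397); the unit cells inside (i)/(ii) are moreover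
`BSD(E,p)` over `PublishedInputsX6` alone (`UpperHalfX6`), which the sharper route-currency residual
`EisensteinHalfFiveLeRest ∧ EisensteinHalfAtThree` of §1 records. CONDITIONAL on both conjunctions.
[cite: Kobayashi2003, Thm. 1.2 (p. 2) and Thm. 4.1 (p. 8)] [cite: BDKim2013, Cor. 3.15 (p. 199)]
[cite: Miller2011LMS, §1 and Def. 1.1] -/
theorem wallCornerX6r0_iff_forall_bsdp_rest_and_three_of_publishedInputsX6_of_publishedAcInputsX6Err
    (hPub : PublishedInputsX6) (hAc : PublishedAcInputsX6Err) :
    Summit.BirchSwinnertonDyer.WAllCornerX6r0 ↔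
      ((∀ (W : WeierstrassCurve ℚ) [W.IsElliptic] [W.IsGloballyMinimal] (p : ℕ) [Fact p.Prime],
          5 ≤ p → ClassX6 W p → W.analyticRank = 0 → ¬ HasErratumPrime W p → BSDp W p) ∧
        ∀ (W : WeierstrassCurve ℚ) [W.IsElliptic] [W.IsGloballyMinimal] (p : ℕ) [Fact p.Prime],
          p = 3 → ClassX6 W p → W.analyticRank = 0 → BSDp W p) := by
  refine ⟨fun h => ⟨fun W _ _ p _ h5 hX h0 _ => h W p (ClassX6.not_hasCM W hX) (by omega) hX h0,
    fun W _ _ p _ h3 hX h0 => h W p (ClassX6.not_hasCM W hX) (by omega) hX h0⟩, ?_⟩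
  rintro ⟨hR, hT⟩ W _ _ p _ _ hp2 hX h0
  by_cases hp3 : p = 3
  · exact hT W p hp3 hX h0
  · have h5 : 5 ≤ p := five_le_of_odd_prime_ne_three Fact.out hp2 hp3
    by_cases hE : HasErratumPrime W p
    · exact X6.bsdp_of_publishedInputsX6_of_publishedAcInputsX6Err_of_hasErratumPrime W p hPub hAc h5 hX
        h0 hE
    · exact hR W p h5 hX h0 hE

end Summit.BirchSwinnertonDyer.BirchSwinnertonDyer.Theorems
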